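import Literature.NumberTheory.Rogawski1990.ArchLimitFormulaNoncompactWallLinksOfTransport   -- ★ p842445: `quotientMeasure_smul_nnreal`, `…_clause_of_isHaarMeasure` (§0), links; brings ★ (b1), ★ (b2′), ★ p841778, ★ p840202
import Literature.NumberTheory.Rogawski1990.ArchLimitFormulaNoncompactWallSigned             -- ★ `archLimitFormulaNoncompactWall_signed`: the letter with `∃ c : ℝ, c < 0`
import Literature.NumberTheory.Automorphic.UnitaryGroupDiagTraceExplicitWeights              -- ★ p813740 §1: `quotientMeasure_eq_inv_smul_of_eq_smul` (`ν∕(k•ρ) = k⁻¹•(ν∕ρ)`, generic)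
import HarnessLib

/-!
# The SELF-NORMALISING PIN at a noncompact wall: the centraliser Haar measure whose (J-nc) constant is `−1` — scaling law, existence, uniqueness
(Rogawski (1990) §8.2 pp. 119, 122–124; Varadarajan (1989) §6.4 Thm 22; Deitmar–Echterhoff (2014) Thm. 1.5.3)

Topic `NumberTheory/Rogawski1990`; namespace `Literature.NumberTheory.Rogawski1990`.  THEOREMS ONLY (no definition, no instance,
no notation, no named fact, no `sorry`).  Cell `pub/hodgecm-mathlib`, crux H413 (`stmt-HodgeConjecture-24833`); (ST-∞) witness road (W1) of census `CENSUS-E4b-SingularPinsBuilt` 1291225b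
(F0P3-p03 (g10)), PIN CHOICE (i) «self-normalising» (F0P3a-p07 (g8) «=» 08:29:47Z); author F0P3-p03 (g10), 2026-09-01.  Count-neutral plumbing; HONEST LABEL: HC_CM is proved only modulo
the printed citations until rung 0 closes.

WHAT.  In the (J-nc) clause of ★ `ArchLimitFormulaNoncompactWall L β w` for a datum `(ν, z₁, ν_H)` the constant `c` is a function of `ν_H` alone (★ p842445 §0) and is HOMOGENEOUS OF DEGREE
ONE in it: ★ `quotientMeasure_eq_inv_smul_of_eq_smul` (`ν∕(k•ρ) = k⁻¹•(ν∕ρ)`, ★ p813740 §1) ⇒ §B `archLimitFormulaNoncompactWall_clause_of_eq_smul_centralizer` (clause for `(ν_H, c)` ⇒ clause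
for `(k•ν_H, k·c)`).  Since the letter holds with a NEGATIVE real constant (★ `archLimitFormulaNoncompactWall_signed`: `c₀ < 0` for any inversion-invariant Haar `ν_H⁰`), scaling by
`k = (−c₀)⁻¹` gives §C **`exists_centralizer_measure_clause_neg_one`**: an inversion-invariant Haar measure `ν_H` on `Z_w(diag z₁)` whose (J-nc) constant is EXACTLY `−1` (for the
given — hence, by ★ p842445 §0b, for every — group Haar measure `ν`).  §D **`centralizer_measure_eq_of_clause`**: two inversion-invariant Haar measures with the SAME non-zero constant
are EQUAL (Haar uniqueness on `Z` + §B + ★ p841778 `archLimitFormulaNoncompactWall_const_unique`) — the pin «constant `= −1`» determines `ν_H`.  With this pin the (D5) binders read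
`c v τ = −1`, `M v = 1`, `hC` by `rfl` (F0P3a-p07 (g8), CENSUS-R1i-END (E5) collapses); the transport invariance of the pin (the (T02)(T01) links for pinned families) is the sibling file.

## References
* [Rogawski1990] J. D. Rogawski, *Automorphic Representations of Unitary Groups in Three Variables*, Ann. of Math. Stud. 123 (1990), §8.2 pp. 119, 122–124.
* [Varadarajan1989] V. S. Varadarajan, *An Introduction to Harmonic Analysis on Semisimple Lie Groups* (1989), §6.4 Thm 22, Lemma 21.
* [DeitmarEchterhoff2014] A. Deitmar, S. Echterhoff, *Principles of Harmonic Analysis*, 2nd ed. (2014), Lemma 1.5.1, Thm. 1.5.3.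
-/

set_option autoImplicit false

noncomputable section

open MeasureTheory Measure Filter Topology NumberField NumberField.InfinitePlace Matrix Equiv
open Literature.MeasureTheory.Group Literature.NumberTheory.Automorphic Literature.NumberTheory.Automorphic.UnitaryGroup
open Literature.LinearAlgebra.Matrix
open scoped Matrix MatrixGroups Matrix.Norms.Operator NNReal ENNReal

namespace Literature.NumberTheory.Rogawski1990

/-! ## §B The (J-nc) clause scales with the centraliser measure -/

section Scaling

variable (L : Type) [Field L] (β : Fin 3 → L) (w : {w : InfinitePlace L // IsComplex w})

/-- **THE (J-nc) CONSTANT IS HOMOGENEOUS OF DEGREE ONE IN THE CENTRALISER MEASURE**: if `c` satisfies the clause of ★ `ArchLimitFormulaNoncompactWall L β w` for `(ν, z₁, ν_H)`, then `k·c`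
satisfies it for `(ν, z₁, k•ν_H)` (`k ≠ 0`): the singular side is `∫ … d(ν∕(k•ν_H)) = k⁻¹ ∫ … d(ν∕ν_H)` (★ `quotientMeasure_eq_inv_smul_of_eq_smul`), the regular side is unchanged.
[cite: Rogawski1990, §8.2 p. 119; p. 123] [cite: DeitmarEchterhoff2014, Thm. 1.5.3] -/
theorem archLimitFormulaNoncompactWall_clause_of_eq_smul_centralizer
    [iG : LocallyCompactSpace (archLocal L 3 (Matrix.diagonal β) w)] [iGs : SecondCountableTopology (archLocal L 3 (Matrix.diagonal β) w)] [MeasurableSpace (archLocal L 3 (Matrix.diagonal β) w)] [BorelSpace (archLocal L 3 (Matrix.diagonal β) w)]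
    (ν : Measure (archLocal L 3 (Matrix.diagonal β) w)) [iνh : ν.IsHaarMeasure] [iνr : ν.IsMulRightInvariant]
    (z₁ : Fin 3 → Circle) (h02 : z₁ 0 = z₁ 2) (h01 : z₁ 0 ≠ z₁ 1)
    (νH : Measure (Subgroup.centralizer ({(⟨circleDiagonal 3 z₁, circleDiagonal_mem_archLocal_diagonal L 3 β w z₁⟩ : archLocal L 3 (Matrix.diagonal β) w)} : Set (archLocal L 3 (Matrix.diagonal β) w)))) [iνHh : νH.IsHaarMeasure] [iνHi : νH.IsInvInvariant]
    (νH' : Measure (Subgroup.centralizer ({(⟨circleDiagonal 3 z₁, circleDiagonal_mem_archLocal_diagonal L 3 β w z₁⟩ : archLocal L 3 (Matrix.diagonal β) w)} : Set (archLocal L 3 (Matrix.diagonal β) w)))) [iνH'h : νH'.IsHaarMeasure] [iνH'i : νH'.IsInvInvariant]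
    (k : ℝ≥0) (hk : k ≠ 0) (hνH' : νH' = k • νH)
    [iQ : MeasurableSpace (archLocal L 3 (Matrix.diagonal β) w ⧸ Subgroup.centralizer ({(⟨circleDiagonal 3 z₁, circleDiagonal_mem_archLocal_diagonal L 3 β w z₁⟩ : archLocal L 3 (Matrix.diagonal β) w)} : Set (archLocal L 3 (Matrix.diagonal β) w)))] [iQb : BorelSpace (archLocal L 3 (Matrix.diagonal β) w ⧸ Subgroup.centralizer ({(⟨circleDiagonal 3 z₁, circleDiagonal_mem_archLocal_diagonal L 3 β w z₁⟩ : archLocal L 3 (Matrix.diagonal β) w)} : Set (archLocal L 3 (Matrix.diagonal β) w)))]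
    (c : ℂ)
    (hc : ∀ (Θ : Matrix (Fin 3) (Fin 3) ℂ → ℂ), ContDiff ℝ (⊤ : ℕ∞) Θ →
        HasCompactSupport (fun k : archLocal L 3 (Matrix.diagonal β) w => Θ ((k : GL (Fin 3) ℂ) : Matrix (Fin 3) (Fin 3) ℂ)) →
        ∀ (z₀ : Fin 3 → Circle) (h02' : z₀ 0 = z₀ 2) (h01' : z₀ 0 ≠ z₀ 1),
          Tendsto (fun ψ : ℝ => deriv (fun ψ : ℝ => (2 * Real.sin ψ : ℂ) *
              ∫ g, Θ (((g * ⟨circleDiagonal 3 (fun i => z₀ i * Circle.exp (![(1 : ℝ), 0, -1] i * ψ)),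
                circleDiagonal_mem_archLocal_diagonal L 3 β w _⟩ * g⁻¹ : archLocal L 3 (Matrix.diagonal β) w) : GL (Fin 3) ℂ) : Matrix (Fin 3) (Fin 3) ℂ) ∂(ν)) ψ)
            (𝓝[≠] 0)
            (𝓝 (c * ∫ y, descConj (⟨circleDiagonal 3 z₀, circleDiagonal_mem_archLocal_diagonal L 3 β w z₀⟩ : archLocal L 3 (Matrix.diagonal β) w)
              (Subgroup.centralizer ({(⟨circleDiagonal 3 z₁, circleDiagonal_mem_archLocal_diagonal L 3 β w z₁⟩ : archLocal L 3 (Matrix.diagonal β) w)} : Set (archLocal L 3 (Matrix.diagonal β) w)))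
              (forall_mem_centralizer_circleDiagonal_comm_of_wall L β w h02 h01 h02' h01')
              (fun k : archLocal L 3 (Matrix.diagonal β) w => Θ ((k : GL (Fin 3) ℂ) : Matrix (Fin 3) (Fin 3) ℂ)) y
              ∂(quotientMeasure _ (νH) (isClosed_coe_centralizer_singleton _) (ν))))) :
    ∀ (Θ : Matrix (Fin 3) (Fin 3) ℂ → ℂ), ContDiff ℝ (⊤ : ℕ∞) Θ →
        HasCompactSupport (fun k : archLocal L 3 (Matrix.diagonal β) w => Θ ((k : GL (Fin 3) ℂ) : Matrix (Fin 3) (Fin 3) ℂ)) →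
        ∀ (z₀ : Fin 3 → Circle) (h02' : z₀ 0 = z₀ 2) (h01' : z₀ 0 ≠ z₀ 1),
          Tendsto (fun ψ : ℝ => deriv (fun ψ : ℝ => (2 * Real.sin ψ : ℂ) *
              ∫ g, Θ (((g * ⟨circleDiagonal 3 (fun i => z₀ i * Circle.exp (![(1 : ℝ), 0, -1] i * ψ)),
                circleDiagonal_mem_archLocal_diagonal L 3 β w _⟩ * g⁻¹ : archLocal L 3 (Matrix.diagonal β) w) : GL (Fin 3) ℂ) : Matrix (Fin 3) (Fin 3) ℂ) ∂(ν)) ψ)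
            (𝓝[≠] 0)
            (𝓝 ((((k : ℝ) : ℂ) * c) * ∫ y, descConj (⟨circleDiagonal 3 z₀, circleDiagonal_mem_archLocal_diagonal L 3 β w z₀⟩ : archLocal L 3 (Matrix.diagonal β) w)
              (Subgroup.centralizer ({(⟨circleDiagonal 3 z₁, circleDiagonal_mem_archLocal_diagonal L 3 β w z₁⟩ : archLocal L 3 (Matrix.diagonal β) w)} : Set (archLocal L 3 (Matrix.diagonal β) w)))
              (forall_mem_centralizer_circleDiagonal_comm_of_wall L β w h02 h01 h02' h01')
              (fun k : archLocal L 3 (Matrix.diagonal β) w => Θ ((k : GL (Fin 3) ℂ) : Matrix (Fin 3) (Fin 3) ℂ)) y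
              ∂(quotientMeasure _ (νH') (isClosed_coe_centralizer_singleton _) (ν)))) := by
  intro Θ hΘ hΘc z₀ h02' h01'
  haveI : LocallyCompactSpace (Subgroup.centralizer ({(⟨circleDiagonal 3 z₁, circleDiagonal_mem_archLocal_diagonal L 3 β w z₁⟩ : archLocal L 3 (Matrix.diagonal β) w)} : Set (archLocal L 3 (Matrix.diagonal β) w))) :=
    (isClosed_coe_centralizer_singleton _).isClosedEmbedding_subtypeVal.locallyCompactSpace
  haveI : SecondCountableTopology (Subgroup.centralizer ({(⟨circleDiagonal 3 z₁, circleDiagonal_mem_archLocal_diagonal L 3 β w z₁⟩ : archLocal L 3 (Matrix.diagonal β) w)} : Set (archLocal L 3 (Matrix.diagonal β) w))) :=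
    TopologicalSpace.Subtype.secondCountableTopology _
  have hq : quotientMeasure _ νH' (isClosed_coe_centralizer_singleton _) ν =
      k⁻¹ • quotientMeasure _ νH (isClosed_coe_centralizer_singleton
        (⟨circleDiagonal 3 z₁, circleDiagonal_mem_archLocal_diagonal L 3 β w z₁⟩ : archLocal L 3 (Matrix.diagonal β) w)) ν :=
    quotientMeasure_eq_inv_smul_of_eq_smul (hH := isClosed_coe_centralizer_singleton _)
      (Subgroup.centralizer ({(⟨circleDiagonal 3 z₁, circleDiagonal_mem_archLocal_diagonal L 3 β w z₁⟩ : archLocal L 3 (Matrix.diagonal β) w)} : Set (archLocal L 3 (Matrix.diagonal β) w)))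
      ν νH νH' k hk hνH'
  rw [hq, integral_smul_nnreal_measure, NNReal.smul_def, Complex.real_smul, NNReal.coe_inv, Complex.ofReal_inv,
    show (((k : ℝ) : ℂ) * c) * ((((k : ℝ) : ℂ))⁻¹ * ∫ y, descConj (⟨circleDiagonal 3 z₀, circleDiagonal_mem_archLocal_diagonal L 3 β w z₀⟩ : archLocal L 3 (Matrix.diagonal β) w)
        (Subgroup.centralizer ({(⟨circleDiagonal 3 z₁, circleDiagonal_mem_archLocal_diagonal L 3 β w z₁⟩ : archLocal L 3 (Matrix.diagonal β) w)} : Set (archLocal L 3 (Matrix.diagonal β) w)))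
        (forall_mem_centralizer_circleDiagonal_comm_of_wall L β w h02 h01 h02' h01')
        (fun k : archLocal L 3 (Matrix.diagonal β) w => Θ ((k : GL (Fin 3) ℂ) : Matrix (Fin 3) (Fin 3) ℂ)) y
        ∂(quotientMeasure _ νH (isClosed_coe_centralizer_singleton _) ν)) =
      c * ∫ y, descConj (⟨circleDiagonal 3 z₀, circleDiagonal_mem_archLocal_diagonal L 3 β w z₀⟩ : archLocal L 3 (Matrix.diagonal β) w)
        (Subgroup.centralizer ({(⟨circleDiagonal 3 z₁, circleDiagonal_mem_archLocal_diagonal L 3 β w z₁⟩ : archLocal L 3 (Matrix.diagonal β) w)} : Set (archLocal L 3 (Matrix.diagonal β) w)))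
        (forall_mem_centralizer_circleDiagonal_comm_of_wall L β w h02 h01 h02' h01')
        (fun k : archLocal L 3 (Matrix.diagonal β) w => Θ ((k : GL (Fin 3) ℂ) : Matrix (Fin 3) (Fin 3) ℂ)) y
        ∂(quotientMeasure _ νH (isClosed_coe_centralizer_singleton _) ν) by
      have hk' : ((k : ℝ) : ℂ) ≠ 0 := Complex.ofReal_ne_zero.2 (NNReal.coe_ne_zero.2 hk)
      field_simp]
  exact hc Θ hΘ hΘc z₀ h02' h01'

end Scaling

/-! ## §C Existence of the pinned measure: constant EXACTLY `−1` -/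

section Existence

variable (L : Type) [Field L] [NumberField L] [IsCMField L] (β : Fin 3 → L) (w : {w : InfinitePlace L // IsComplex w})

/-- **THE SELF-NORMALISING PIN EXISTS.**  At a frame `β` whose `{0,2}`-wall is noncompact at `w`, for every group Haar measure `ν` and reference wall point `z₁`, there is an
inversion-invariant Haar measure `ν_H` on `Z_w(diag z₁)` whose (J-nc) constant is exactly `−1`: ★ `archLimitFormulaNoncompactWall_signed` gives `c₀ < 0` for any inversion-invariant
Haar `ν_H⁰` (one must be supplied: `νH₀`), and `ν_H := (−c₀)⁻¹ • ν_H⁰` has constant `(−c₀)⁻¹·c₀ = −1` (§B).  (By ★ p842445 §0b the same `ν_H` then has constant `−1` for EVERY Haar `ν`.)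
[cite: Rogawski1990, §8.2 p. 119; pp. 122–124] [cite: Varadarajan1989, §6.4 Thm 22] -/
theorem exists_centralizer_measure_clause_neg_one
    [iG : LocallyCompactSpace (archLocal L 3 (Matrix.diagonal β) w)] [iGs : SecondCountableTopology (archLocal L 3 (Matrix.diagonal β) w)] [MeasurableSpace (archLocal L 3 (Matrix.diagonal β) w)] [BorelSpace (archLocal L 3 (Matrix.diagonal β) w)]
    (hβ : ∀ i, β i ≠ 0) (hreal : ∀ i, (w.1.embedding (β i)).im = 0)
    (hnc : (w.1.embedding (β 0)).re * (w.1.embedding (β 2)).re < 0)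
    (ν : Measure (archLocal L 3 (Matrix.diagonal β) w)) [iνh : ν.IsHaarMeasure] [iνr : ν.IsMulRightInvariant]
    (z₁ : Fin 3 → Circle) (h02 : z₁ 0 = z₁ 2) (h01 : z₁ 0 ≠ z₁ 1)
    (νH₀ : Measure (Subgroup.centralizer ({(⟨circleDiagonal 3 z₁, circleDiagonal_mem_archLocal_diagonal L 3 β w z₁⟩ : archLocal L 3 (Matrix.diagonal β) w)} : Set (archLocal L 3 (Matrix.diagonal β) w)))) [iνH₀h : νH₀.IsHaarMeasure] [iνH₀i : νH₀.IsInvInvariant]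
    [iQ : MeasurableSpace (archLocal L 3 (Matrix.diagonal β) w ⧸ Subgroup.centralizer ({(⟨circleDiagonal 3 z₁, circleDiagonal_mem_archLocal_diagonal L 3 β w z₁⟩ : archLocal L 3 (Matrix.diagonal β) w)} : Set (archLocal L 3 (Matrix.diagonal β) w)))] [iQb : BorelSpace (archLocal L 3 (Matrix.diagonal β) w ⧸ Subgroup.centralizer ({(⟨circleDiagonal 3 z₁, circleDiagonal_mem_archLocal_diagonal L 3 β w z₁⟩ : archLocal L 3 (Matrix.diagonal β) w)} : Set (archLocal L 3 (Matrix.diagonal β) w)))] :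
    ∃ νH : Measure (Subgroup.centralizer ({(⟨circleDiagonal 3 z₁, circleDiagonal_mem_archLocal_diagonal L 3 β w z₁⟩ : archLocal L 3 (Matrix.diagonal β) w)} : Set (archLocal L 3 (Matrix.diagonal β) w))), ∃ (_ : νH.IsHaarMeasure) (_ : νH.IsInvInvariant),
    ∀ (Θ : Matrix (Fin 3) (Fin 3) ℂ → ℂ), ContDiff ℝ (⊤ : ℕ∞) Θ →
        HasCompactSupport (fun k : archLocal L 3 (Matrix.diagonal β) w => Θ ((k : GL (Fin 3) ℂ) : Matrix (Fin 3) (Fin 3) ℂ)) →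
        ∀ (z₀ : Fin 3 → Circle) (h02' : z₀ 0 = z₀ 2) (h01' : z₀ 0 ≠ z₀ 1),
          Tendsto (fun ψ : ℝ => deriv (fun ψ : ℝ => (2 * Real.sin ψ : ℂ) *
              ∫ g, Θ (((g * ⟨circleDiagonal 3 (fun i => z₀ i * Circle.exp (![(1 : ℝ), 0, -1] i * ψ)),
                circleDiagonal_mem_archLocal_diagonal L 3 β w _⟩ * g⁻¹ : archLocal L 3 (Matrix.diagonal β) w) : GL (Fin 3) ℂ) : Matrix (Fin 3) (Fin 3) ℂ) ∂(ν)) ψ)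
            (𝓝[≠] 0)
            (𝓝 ((-1 : ℂ) * ∫ y, descConj (⟨circleDiagonal 3 z₀, circleDiagonal_mem_archLocal_diagonal L 3 β w z₀⟩ : archLocal L 3 (Matrix.diagonal β) w)
              (Subgroup.centralizer ({(⟨circleDiagonal 3 z₁, circleDiagonal_mem_archLocal_diagonal L 3 β w z₁⟩ : archLocal L 3 (Matrix.diagonal β) w)} : Set (archLocal L 3 (Matrix.diagonal β) w)))
              (forall_mem_centralizer_circleDiagonal_comm_of_wall L β w h02 h01 h02' h01')
              (fun k : archLocal L 3 (Matrix.diagonal β) w => Θ ((k : GL (Fin 3) ℂ) : Matrix (Fin 3) (Fin 3) ℂ)) y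
              ∂(quotientMeasure _ (νH) (isClosed_coe_centralizer_singleton _) (ν)))) := by
  obtain ⟨c₀, hc₀, hcl⟩ := archLimitFormulaNoncompactWall_signed L β w hβ hreal ν z₁ h02 h01 hnc νH₀
  -- the scaling factor `k = (−c₀)⁻¹ > 0`
  have hk0 : 0 < (-c₀)⁻¹ := inv_pos.2 (neg_pos.2 hc₀)
  set k : ℝ≥0 := ⟨(-c₀)⁻¹, hk0.le⟩ with hk_def
  have hk : k ≠ 0 := by
    intro h
    have h' : ((k : ℝ≥0) : ℝ) = 0 := by rw [h]; simp
    exact hk0.ne' h'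
  have hkc : (k : ℝ≥0∞) ≠ 0 := ENNReal.coe_ne_zero.2 hk
  -- the scaled measure `(k : ℝ≥0∞) • νH₀ = k • νH₀` and its instances
  have hcoe : ((k : ℝ≥0∞) • νH₀ : Measure _) = k • νH₀ := by
    ext s _
    rw [Measure.smul_apply, Measure.coe_nnreal_smul_apply, smul_eq_mul]
  haveI hh : ((k : ℝ≥0∞) • νH₀).IsHaarMeasure := IsHaarMeasure.smul νH₀ hkc ENNReal.coe_ne_top
  haveI hi : ((k : ℝ≥0∞) • νH₀).IsInvInvariant := by
    refine ⟨?_⟩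
    show Measure.map Inv.inv ((k : ℝ≥0∞) • νH₀) = (k : ℝ≥0∞) • νH₀
    rw [Measure.map_smul, Measure.map_inv_eq_self]
  refine ⟨(k : ℝ≥0∞) • νH₀, hh, hi, ?_⟩
  have h := archLimitFormulaNoncompactWall_clause_of_eq_smul_centralizer L β w ν z₁ h02 h01 νH₀ ((k : ℝ≥0∞) • νH₀) k hk hcoe (c₀ : ℂ) hcl
  have hval : ((k : ℝ) : ℂ) * (c₀ : ℂ) = (-1 : ℂ) := by
    have h1 : (k : ℝ) = (-c₀)⁻¹ := rfl
    rw [h1, ← Complex.ofReal_mul]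
    have h2 : (-c₀)⁻¹ * c₀ = -1 := by
      rw [inv_neg, neg_mul, inv_mul_cancel₀ hc₀.ne]
    rw [h2]; push_cast; ring
  rw [hval] at h
  exact h

end Existence

/-! ## §D Uniqueness of the pinned measure -/

section Uniqueness

variable (L : Type) [Field L] [NumberField L] [IsCMField L] (β : Fin 3 → L) (w : {w : InfinitePlace L // IsComplex w})

/-- **TWO CENTRALISER MEASURES WITH THE SAME NON-ZERO (J-nc) CONSTANT ARE EQUAL.**  If inversion-invariant Haar measures `ν_H¹`, `ν_H²` on `Z_w(diag z₁)` both satisfy the clause of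
★ `ArchLimitFormulaNoncompactWall L β w` at `(ν, z₁)` with the same constant `c ≠ 0`, then `ν_H¹ = ν_H²`: `ν_H² = k • ν_H¹` (Haar uniqueness on `Z`), so `k·c` is also a constant for
`(ν, z₁, ν_H²)` (§B), and ★ `archLimitFormulaNoncompactWall_const_unique` forces `k·c = c`, `k = 1`.  In particular the pin «constant `= −1`» DETERMINES the centraliser measure.
[cite: Rogawski1990, §8.2 p. 119; p. 123] [cite: DeitmarEchterhoff2014, Thm. 1.5.3] -/
theorem centralizer_measure_eq_of_clause
    [iG : LocallyCompactSpace (archLocal L 3 (Matrix.diagonal β) w)] [iGs : SecondCountableTopology (archLocal L 3 (Matrix.diagonal β) w)] [MeasurableSpace (archLocal L 3 (Matrix.diagonal β) w)] [BorelSpace (archLocal L 3 (Matrix.diagonal β) w)]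
    (hβ : ∀ i, β i ≠ 0) (hreal : ∀ i, (w.1.embedding (β i)).im = 0)
    (ν : Measure (archLocal L 3 (Matrix.diagonal β) w)) [iνh : ν.IsHaarMeasure] [iνr : ν.IsMulRightInvariant]
    (z₁ : Fin 3 → Circle) (h02 : z₁ 0 = z₁ 2) (h01 : z₁ 0 ≠ z₁ 1)
    (νH₁ : Measure (Subgroup.centralizer ({(⟨circleDiagonal 3 z₁, circleDiagonal_mem_archLocal_diagonal L 3 β w z₁⟩ : archLocal L 3 (Matrix.diagonal β) w)} : Set (archLocal L 3 (Matrix.diagonal β) w)))) [iνH₁h : νH₁.IsHaarMeasure] [iνH₁i : νH₁.IsInvInvariant]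
    (νH₂ : Measure (Subgroup.centralizer ({(⟨circleDiagonal 3 z₁, circleDiagonal_mem_archLocal_diagonal L 3 β w z₁⟩ : archLocal L 3 (Matrix.diagonal β) w)} : Set (archLocal L 3 (Matrix.diagonal β) w)))) [iνH₂h : νH₂.IsHaarMeasure] [iνH₂i : νH₂.IsInvInvariant]
    [iQ : MeasurableSpace (archLocal L 3 (Matrix.diagonal β) w ⧸ Subgroup.centralizer ({(⟨circleDiagonal 3 z₁, circleDiagonal_mem_archLocal_diagonal L 3 β w z₁⟩ : archLocal L 3 (Matrix.diagonal β) w)} : Set (archLocal L 3 (Matrix.diagonal β) w)))] [iQb : BorelSpace (archLocal L 3 (Matrix.diagonal β) w ⧸ Subgroup.centralizer ({(⟨circleDiagonal 3 z₁, circleDiagonal_mem_archLocal_diagonal L 3 β w z₁⟩ : archLocal L 3 (Matrix.diagonal β) w)} : Set (archLocal L 3 (Matrix.diagonal β) w)))]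
    {c : ℂ} (hc0 : c ≠ 0)
    (h₁ : ∀ (Θ : Matrix (Fin 3) (Fin 3) ℂ → ℂ), ContDiff ℝ (⊤ : ℕ∞) Θ →
        HasCompactSupport (fun k : archLocal L 3 (Matrix.diagonal β) w => Θ ((k : GL (Fin 3) ℂ) : Matrix (Fin 3) (Fin 3) ℂ)) →
        ∀ (z₀ : Fin 3 → Circle) (h02' : z₀ 0 = z₀ 2) (h01' : z₀ 0 ≠ z₀ 1),
          Tendsto (fun ψ : ℝ => deriv (fun ψ : ℝ => (2 * Real.sin ψ : ℂ) *
              ∫ g, Θ (((g * ⟨circleDiagonal 3 (fun i => z₀ i * Circle.exp (![(1 : ℝ), 0, -1] i * ψ)),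
                circleDiagonal_mem_archLocal_diagonal L 3 β w _⟩ * g⁻¹ : archLocal L 3 (Matrix.diagonal β) w) : GL (Fin 3) ℂ) : Matrix (Fin 3) (Fin 3) ℂ) ∂(ν)) ψ)
            (𝓝[≠] 0)
            (𝓝 (c * ∫ y, descConj (⟨circleDiagonal 3 z₀, circleDiagonal_mem_archLocal_diagonal L 3 β w z₀⟩ : archLocal L 3 (Matrix.diagonal β) w)
              (Subgroup.centralizer ({(⟨circleDiagonal 3 z₁, circleDiagonal_mem_archLocal_diagonal L 3 β w z₁⟩ : archLocal L 3 (Matrix.diagonal β) w)} : Set (archLocal L 3 (Matrix.diagonal β) w)))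
              (forall_mem_centralizer_circleDiagonal_comm_of_wall L β w h02 h01 h02' h01')
              (fun k : archLocal L 3 (Matrix.diagonal β) w => Θ ((k : GL (Fin 3) ℂ) : Matrix (Fin 3) (Fin 3) ℂ)) y
              ∂(quotientMeasure _ (νH₁) (isClosed_coe_centralizer_singleton _) (ν)))))
    (h₂ : ∀ (Θ : Matrix (Fin 3) (Fin 3) ℂ → ℂ), ContDiff ℝ (⊤ : ℕ∞) Θ →
        HasCompactSupport (fun k : archLocal L 3 (Matrix.diagonal β) w => Θ ((k : GL (Fin 3) ℂ) : Matrix (Fin 3) (Fin 3) ℂ)) →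
        ∀ (z₀ : Fin 3 → Circle) (h02' : z₀ 0 = z₀ 2) (h01' : z₀ 0 ≠ z₀ 1),
          Tendsto (fun ψ : ℝ => deriv (fun ψ : ℝ => (2 * Real.sin ψ : ℂ) *
              ∫ g, Θ (((g * ⟨circleDiagonal 3 (fun i => z₀ i * Circle.exp (![(1 : ℝ), 0, -1] i * ψ)),
                circleDiagonal_mem_archLocal_diagonal L 3 β w _⟩ * g⁻¹ : archLocal L 3 (Matrix.diagonal β) w) : GL (Fin 3) ℂ) : Matrix (Fin 3) (Fin 3) ℂ) ∂(ν)) ψ)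
            (𝓝[≠] 0)
            (𝓝 (c * ∫ y, descConj (⟨circleDiagonal 3 z₀, circleDiagonal_mem_archLocal_diagonal L 3 β w z₀⟩ : archLocal L 3 (Matrix.diagonal β) w)
              (Subgroup.centralizer ({(⟨circleDiagonal 3 z₁, circleDiagonal_mem_archLocal_diagonal L 3 β w z₁⟩ : archLocal L 3 (Matrix.diagonal β) w)} : Set (archLocal L 3 (Matrix.diagonal β) w)))
              (forall_mem_centralizer_circleDiagonal_comm_of_wall L β w h02 h01 h02' h01')
              (fun k : archLocal L 3 (Matrix.diagonal β) w => Θ ((k : GL (Fin 3) ℂ) : Matrix (Fin 3) (Fin 3) ℂ)) y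
              ∂(quotientMeasure _ (νH₂) (isClosed_coe_centralizer_singleton _) (ν))))) :
    νH₁ = νH₂ := by
  -- `Z` is a closed subgroup of a second countable locally compact group
  haveI : LocallyCompactSpace (Subgroup.centralizer ({(⟨circleDiagonal 3 z₁, circleDiagonal_mem_archLocal_diagonal L 3 β w z₁⟩ : archLocal L 3 (Matrix.diagonal β) w)} : Set (archLocal L 3 (Matrix.diagonal β) w))) :=
    (isClosed_coe_centralizer_singleton _).isClosedEmbedding_subtypeVal.locallyCompactSpace
  haveI : SecondCountableTopology (Subgroup.centralizer ({(⟨circleDiagonal 3 z₁, circleDiagonal_mem_archLocal_diagonal L 3 β w z₁⟩ : archLocal L 3 (Matrix.diagonal β) w)} : Set (archLocal L 3 (Matrix.diagonal β) w))) :=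
    TopologicalSpace.Subtype.secondCountableTopology _
  -- Haar uniqueness: `νH₂ = k • νH₁`
  have hk := isMulLeftInvariant_eq_smul νH₂ νH₁
  set k : ℝ≥0 := νH₂.haarScalarFactor νH₁ with hk_def
  have hkpos : 0 < k := haarScalarFactor_pos_of_isHaarMeasure νH₂ νH₁
  have hk0 : k ≠ 0 := hkpos.ne'
  -- `k·c` is a constant for `νH₂`, hence `k·c = c`
  have h₂' := archLimitFormulaNoncompactWall_clause_of_eq_smul_centralizer L β w ν z₁ h02 h01 νH₁ νH₂ k hk0 hk c h₁
  have heq : ((k : ℝ) : ℂ) * c = c := archLimitFormulaNoncompactWall_const_unique L β w hβ hreal ν h02 h01 νH₂ h₂' h₂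
  have hk1 : (k : ℝ) = 1 := by
    have : ((k : ℝ) : ℂ) = 1 := by
      have h := mul_right_cancel₀ hc0 (heq.trans (one_mul c).symm)
      exact h
    exact_mod_cast this
  have hk1' : k = 1 := NNReal.coe_injective (by rw [hk1]; rfl)
  rw [hk, hk1', one_smul]

end Uniqueness

end Literature.NumberTheory.Rogawski1990

end
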